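import Summits.ValiantsHypothesis.ValiantsHypothesis.Theses.DivisionGap
import Literature.Computability.AlgebraicComplexity.BirkhoffShadow
import Literature.Computability.AlgebraicComplexity.BirkhoffShadowLowerBound
import Summits.ValiantsHypothesis.ValiantsHypothesis.Theorems.DivisionGapShadowBirkhoffStubFacePad
import Summits.ValiantsHypothesis.ValiantsHypothesis.Theorems.DivisionGapShadowBirkhoffStubFaceVertices
-- (landed negative lemmas, read and checked against by hand — see the docstring and the line card:
--  `Summits.ValiantsHypothesis.ValiantsHypothesis.Theorems.ShadowBirkhoff.Negative.Pencils`;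
--  not imported: the module was not yet built on the farm at planning time)

/-!
# `DivisionGap.ShadowBirkhoff` (stmt-ValiantsHypothesis-5069) — line `parabola-register-face`

Crux (route DivisionGap, decl `ShadowBirkhoff`): the shadow complexity `σ(DS_n)` of the Birkhoff
polytope is super-quasi-polynomial — for every `c`, for all large `n`, some linear
`L : ℝ^{n×n} → ℝ²` projects the `n!` permutation matrices onto a polygon with more than
`2^{(⌊log₂ n⌋ + c)^c}` vertices.

THE LINE (idea card `Cruxes/ShadowBirkhoff/Ideas/parabola-register-face.md`, triage r1: 3 × pass).
A **face counter of order `m` inside `DS_N`** is a 0/1 pattern `G ⊆ [N]²`, two weight tables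
`wb, wa` and a strictly convex `φ : ℝ → ℝ` (with a subgradient selection `ψ`) such that along every
permutation `ρ` supported in `G` the `a`-weight dominates `φ` of the `b`-weight,
`φ(Σ_u wb(u, ρ u)) ≤ Σ_u wa(u, ρ u)`, with EQUALITY realised at `≥ 2^m` distinct `b`-values
(the intended instance is the parabola `φ t = t²`, `ψ t = 2t`, realised by a REGISTER FACE: `m`
rigid two-state bit cycles with `b`-weights `2^k` and pairwise "pool" readings supplying the cross
terms `2^{k+l+1} e_k e_l`, over the FILTER family of a weight tree — see the line card).
By strict convexity each equality value `t` makes `(t, φ t)` the unique minimiser of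
`y ↦ y₁ − ψ(t)·y₀` over the image of the face, hence — after a penalty on the edges outside `G` —
an exposed, hence extreme, point of the shadow of ALL of `DS_N` under `X ↦ (⟨wb, X⟩, ⟨wa', X⟩)`
(`stub_faceVertices`); padding by fixed diagonal cells moves a face counter of `DS_N` into every
`DS_n`, `n ≥ N` (`stub_facePad`); and polynomial size `N ≤ m^d` (`stub_registerFaces`, the
construction — the whole bet of the line) gives `σ(DS_n) ≥ 2^{m(n)}` with
`m(n) = (⌊log₂ n⌋ + c)^c + m₀ + 1`, `m(n)^d ≤ n` for large `n` (`growth`, proved here from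
polynomial-vs-exponential growth), i.e. the crux (`ShadowBirkhoff_of`, proved here modulo the
three stubs).

Transfer `C⁺ := RegisterFacesExist` (below) is STRONGER than the crux (`σ(DS_n) ≥ 2^{Ω(n^{1/d})}`)
and is the triage-repaired form of the card's `∃ d, ∀ m ≥ 1, CounterFace m (m^d)` (vacuous at
`m = 1`: `TriageR1K1.counterFace_hyp_false`): here `∃ d m₀, ∀ m ≥ m₀, ∃ N ≤ m^d, …`, and `t ↦ t²`
is relaxed to any strictly convex `φ` (triage r1-1/r1-3 sharpening; the parabola remains the
intended witness and trivially satisfies the convexity hypothesis, `parabola_strictConvex`).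

Disproof.lean (cdisprove cycle 1) has no `_false_without_` theorem; what the stub set honours:
`not_shadowBirkhoffQpInt` / values lemma (the `b`-functional of a face counter takes `≥ 2^m`
values by definition — super-quasi-polynomially many along `m(n)`), `not_shadowFunctions`
(injectivity between columns is used: a face counter lives on genuine permutations supported in a
pattern, and the register face is one dense brace, not a product), §7 `ncard_UC_le` (Gusfield cap:
the intended witness is a cyclic perfect-matching face, not a layered-DAG walk face), §8 row-set
entropy (a register face with `m` bit cycles through every pool has row-set entropy `2^{Ω(m)}` at the
middle cut — a design constraint recorded in the line card).  The landed negative file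
`Theorems/ShadowBirkhoff/Negative/Pencils.lean` (read; not importable on the farm at planning
time) refutes no instance of a stub: its lemmas bound vertices by VALUES and by Minkowski
additivity, while a face counter has `≥ 2^m` values and is not a Minkowski sum.

planner-cruxplan-stmt-ValiantsHypothesis-5069-parabola-register-fa-0 · crux-plan (opening) · 2026-08-16.
-/

noncomputable section

open scoped BigOperators
open Filter

namespace Summit.ValiantsHypothesis.ValiantsHypothesis.Cruxes.ShadowBirkhoff.ParabolaRegisterFace

open Literature.Computability.AlgebraicComplexity
open Summit.ValiantsHypothesis.ValiantsHypothesis.Theses.DivisionGap (ShadowBirkhoff)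

set_option linter.unusedVariables false
-- `Summit.ValiantsHypothesis.ValiantsHypothesis.…` is the tree's mandated single-conjunct layout (Sub = Summit).
set_option linter.dupNamespace false

/-! ## Vocabulary (documentation; every stub below is stated with these notions UNFOLDED, over
tree / Mathlib declarations only, so that each stub can be landed from a separate Theorems file) -/

-- Convention: `ρ : Equiv.Perm (Fin N)` is SUPPORTED in the 0/1 pattern `G : Finset (Fin N × Fin N)` when
-- `∀ u, (u, ρ u) ∈ G` (its permutation matrix, entry `(ρ u, u) = 1`, lies on the face of `DS_N` cut out by `G`);
-- its `b`-value is `∑ u, wb u (ρ u)` and its `a`-value `∑ u, wa u (ρ u)` (the indexing of the tree's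
-- `BirkhoffShadowLower.Lmap`, cf. `Lmap_perm_eq`).

/-- **Face counter of order `m` inside `DS_N`** (the card's `CounterFace`, triage-repaired):
a pattern `G`, weights `wb wa : [N] × [N] → ℝ` (indexed `(u, ρ u)` as in the tree's
`BirkhoffShadowLower.Lmap`), a strictly convex `φ` with subgradient selection `ψ`
(`φ t + ψ t · (s − t) < φ s` for `s ≠ t`), DOMINATION `φ(b(ρ)) ≤ a(ρ)` along every permutation
supported in `G`, and at least `2^m` distinct values `t = b(ρ)` of supported `ρ` with EQUALITY
`a(ρ) = φ t`.  Intended witness: `φ t = t²`, `ψ t = 2t`, register face over a filter family. -/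
def FaceCounter (m N : ℕ) : Prop :=
  ∃ (G : Finset (Fin N × Fin N)) (wb wa : Fin N → Fin N → ℝ) (φ ψ : ℝ → ℝ),
    (∀ s t : ℝ, s ≠ t → φ t + ψ t * (s - t) < φ s) ∧
    (∀ ρ : Equiv.Perm (Fin N), (∀ u, (u, ρ u) ∈ G) → φ (∑ u, wb u (ρ u)) ≤ ∑ u, wa u (ρ u)) ∧
    2 ^ m ≤ {t : ℝ | ∃ ρ : Equiv.Perm (Fin N), (∀ u, (u, ρ u) ∈ G) ∧
      ∑ u, wb u (ρ u) = t ∧ ∑ u, wa u (ρ u) = φ t}.ncard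

/-- **Transfer target `C⁺`** of the line: polynomial-size face counters of every large order exist.
Strictly stronger than the crux (`σ(DS_n) ≥ 2^{Ω(n^{1/d})}`); `stub_registerFaces` is literally this
statement unfolded (`registerFacesExist_iff`). -/
def RegisterFacesExist : Prop :=
  ∃ d m₀ : ℕ, ∀ m : ℕ, m₀ ≤ m → ∃ N : ℕ, N ≤ m ^ d ∧ FaceCounter m N

/-- Sanity (non-vacuity of the convexity hypothesis): the intended parabola `φ t = t²` with
`ψ t = 2t` satisfies the strict-convexity-with-subgradient inequality of `FaceCounter`. -/
theorem parabola_strictConvex : ∀ s t : ℝ, s ≠ t → t ^ 2 + (2 * t) * (s - t) < s ^ 2 := by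
  intro s t hst
  have h : 0 < (s - t) * (s - t) := mul_self_pos.mpr (sub_ne_zero.mpr hst)
  nlinarith [h]

/-! ## The three registered stubs -/

/-- **Stub 1 (HARD — the construction; the whole bet of the line): polynomial-size face counters.**
There are `d, m₀` such that for every `m ≥ m₀` some face of some `DS_N`, `N ≤ m^d`, carries two
linear functionals `b = ⟨wb, ·⟩`, `a = ⟨wa, ·⟩` and a strictly convex `φ` with `a ≥ φ ∘ b` on all
its vertices and equality at `≥ 2^m` distinct `b`-values.  Intended witness (idea card): the
REGISTER FACE — bits = rigid alternating cycles `Z_v` for the nodes `v` of a `q`-ary weight tree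
(`b`-weight `q^{-depth v}` on the indicator edge), one monotone "pool" per INCOMPARABLE pair
`{u, v}` (firing edge of `a`-weight `2 b_u b_v`, comparable cross terms folded into the bit's own
`a`-weight), designated matchings = the FILTERS (root-closed subtrees) `T` of the tree, for which
`a(M_T) = b(M_T)²` exactly; `#filters = 2^{Θ(#nodes)}`, size `N = O(#nodes² · slots)`, so `d = 3`
suffices.  Why it might fail: the exchange theorem (BarrierNotes-ideator1 B1) forces zero-cost
mixed ("half-docked") states in every local AND gadget; the bet is that for filter families the
leak states stay above the parabola (protection inequality) — untested beyond LP feasibility of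
the target points (kit j011546/j011603); first action of the lead = the depth-2 instance
(line card, E0). -/
theorem stub_registerFaces :
    ∃ d m₀ : ℕ, ∀ m : ℕ, m₀ ≤ m → ∃ N : ℕ, N ≤ m ^ d ∧
      ∃ (G : Finset (Fin N × Fin N)) (wb wa : Fin N → Fin N → ℝ) (φ ψ : ℝ → ℝ),
        (∀ s t : ℝ, s ≠ t → φ t + ψ t * (s - t) < φ s) ∧
        (∀ ρ : Equiv.Perm (Fin N), (∀ u, (u, ρ u) ∈ G) →
          φ (∑ u, wb u (ρ u)) ≤ ∑ u, wa u (ρ u)) ∧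
        2 ^ m ≤ {t : ℝ | ∃ ρ : Equiv.Perm (Fin N), (∀ u, (u, ρ u) ∈ G) ∧
          ∑ u, wb u (ρ u) = t ∧ ∑ u, wa u (ρ u) = φ t}.ncard := by
  sorry

/-- **Stub 2 (padding / monotonicity in `n`): a face of `DS_N` is a face of every `DS_{N'}`,
`N' ≥ N`, with the same two-dimensional value set.**  Embed `[N] ↪ [N']` by `Fin.castLE`, take
`G' = G ∪ {(v, v) : v ≥ N}` and extend both weight tables by `0`; a permutation of `[N']` supported
in `G'` fixes every `v ≥ N` and restricts to a permutation of `[N]` supported in `G` with the same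
`(b, a)`-value, and conversely (extend by the identity, `Equiv.Perm.extendDomain`). -/
theorem stub_facePad {N N' : ℕ} (h : N ≤ N') (G : Finset (Fin N × Fin N))
    (wb wa : Fin N → Fin N → ℝ) :
    ∃ (G' : Finset (Fin N' × Fin N')) (wb' wa' : Fin N' → Fin N' → ℝ),
      {p : ℝ × ℝ | ∃ ρ' : Equiv.Perm (Fin N'), (∀ u, (u, ρ' u) ∈ G') ∧
          (∑ u, wb' u (ρ' u), ∑ u, wa' u (ρ' u)) = p} =
        {p : ℝ × ℝ | ∃ ρ : Equiv.Perm (Fin N), (∀ u, (u, ρ u) ∈ G) ∧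
          (∑ u, wb u (ρ u), ∑ u, wa u (ρ u)) = p} :=
  Summit.ValiantsHypothesis.ValiantsHypothesis.Theorems.DivisionGapShadowBirkhoff.stub_facePad h G wb wa

/-- **Stub 3 (certification: equality points of a dominated face are shadow vertices of `DS_N`).**
If `φ(b(ρ)) ≤ a(ρ)` along every permutation supported in `G` (with `φ` strictly convex, subgradient
`ψ`), then for a suitable linear `L : ℝ^{N×N} → ℝ²` the number of values `t = b(ρ)` of supported
`ρ` with `a(ρ) = φ t` is at most the number of vertices of the shadow `L(DS_N)`.  Proof route:
`L = BirkhoffShadowLower.Lmap (fun u v => (wb u v, wa u v + P·[(u,v) ∉ G]))` with `P` larger than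
the finitely many defects; on the permutation matrix of `ρ` it evaluates to
`![b(ρ), a(ρ) + P·#{u : (u, ρ u) ∉ G}]` (`Lmap_perm_eq`); for an equality value `t` the point
`![t, φ t]` is the UNIQUE maximiser over the image of the continuous linear functional
`y ↦ ψ(t)·y 0 − y 1` (strict convexity for supported `ρ` with `b(ρ) ≠ t`, domination + equality for
`b(ρ) = t`, the penalty for unsupported `ρ`), hence extreme
(`BirkhoffShadowLower.mem_extremePoints_convexHull_of_forall_lt`); distinct `t` give distinct
points (first coordinate), and the extreme points of the hull of a finite set form a finite set
(`extremePoints_convexHull_subset`), so `Set.ncard_le_ncard_of_injOn` concludes. -/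
theorem stub_faceVertices {N : ℕ} (G : Finset (Fin N × Fin N)) (wb wa : Fin N → Fin N → ℝ)
    (φ ψ : ℝ → ℝ) (hφ : ∀ s t : ℝ, s ≠ t → φ t + ψ t * (s - t) < φ s)
    (hdom : ∀ ρ : Equiv.Perm (Fin N), (∀ u, (u, ρ u) ∈ G) →
      φ (∑ u, wb u (ρ u)) ≤ ∑ u, wa u (ρ u)) :
    ∃ L : (Fin N × Fin N → ℝ) →ₗ[ℝ] (Fin 2 → ℝ),
      {t : ℝ | ∃ ρ : Equiv.Perm (Fin N), (∀ u, (u, ρ u) ∈ G) ∧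
          ∑ u, wb u (ρ u) = t ∧ ∑ u, wa u (ρ u) = φ t}.ncard ≤
        Literature.Computability.AlgebraicComplexity.birkhoffShadowVertexCount L :=
  Summit.ValiantsHypothesis.ValiantsHypothesis.Theorems.DivisionGapShadowBirkhoff.stub_faceVertices
    G wb wa φ ψ hφ hdom

/-! ## Bookkeeping around the stubs (proved) -/

/-- `stub_registerFaces` is literally the transfer target `C⁺`. -/
theorem registerFacesExist_iff :
    RegisterFacesExist ↔
      ∃ d m₀ : ℕ, ∀ m : ℕ, m₀ ≤ m → ∃ N : ℕ, N ≤ m ^ d ∧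
        ∃ (G : Finset (Fin N × Fin N)) (wb wa : Fin N → Fin N → ℝ) (φ ψ : ℝ → ℝ),
          (∀ s t : ℝ, s ≠ t → φ t + ψ t * (s - t) < φ s) ∧
          (∀ ρ : Equiv.Perm (Fin N), (∀ u, (u, ρ u) ∈ G) →
            φ (∑ u, wb u (ρ u)) ≤ ∑ u, wa u (ρ u)) ∧
          2 ^ m ≤ {t : ℝ | ∃ ρ : Equiv.Perm (Fin N), (∀ u, (u, ρ u) ∈ G) ∧
            ∑ u, wb u (ρ u) = t ∧ ∑ u, wa u (ρ u) = φ t}.ncard :=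
  Iff.rfl

/-- `C⁺` holds (modulo stub 1). -/
theorem registerFacesExist : RegisterFacesExist := registerFacesExist_iff.2 stub_registerFaces

/-- The crux is, definitionally, a statement about `birkhoffShadowVertexCount`
(same `Iff.rfl` as `Disproof.shadowBirkhoff_iff`). [folklore] -/
theorem shadowBirkhoff_iff :
    ShadowBirkhoff ↔ ∀ c : ℕ, ∃ n₀ : ℕ, ∀ n ≥ n₀, ∃ L : (Fin n × Fin n → ℝ) →ₗ[ℝ] (Fin 2 → ℝ),
      2 ^ ((Nat.log 2 n + c) ^ c) < birkhoffShadowVertexCount L :=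
  Iff.rfl

/-! ## Growth arithmetic (proved): a super-polylogarithmic order `m(n)` with `m(n)^d ≤ n` -/

/-- Polynomial versus exponential growth: `C · t^e < 2^t` for all large `t`
(as `RazElusiveGeneralProofs.eventually_mul_pow_lt_two_pow`). [folklore] -/
theorem eventually_mul_pow_lt_two_pow (e C : ℕ) : ∃ T : ℕ, ∀ t ≥ T, C * t ^ e < 2 ^ t := by
  have ht := tendsto_pow_const_div_const_pow_of_one_lt e (show (1 : ℝ) < 2 by norm_num)
  have hev : ∀ᶠ t : ℕ in atTop, (t : ℝ) ^ e / 2 ^ t < 1 / (C + 1) :=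
    ht.eventually (gt_mem_nhds (by positivity))
  obtain ⟨T, hT⟩ := eventually_atTop.1 hev
  refine ⟨T, fun t hts => ?_⟩
  have h := hT t hts
  rw [div_lt_div_iff₀ (by positivity) (by positivity), one_mul] at h
  have h' : ((C * t ^ e : ℕ) : ℝ) < ((2 ^ t : ℕ) : ℝ) := by
    push_cast
    calc (C : ℝ) * (t : ℝ) ^ e ≤ (t : ℝ) ^ e * (C + 1) := by
          nlinarith [pow_nonneg (Nat.cast_nonneg t : (0:ℝ) ≤ t) e]
      _ < 2 ^ t := h
  exact_mod_cast h'

/-- **Growth.** For all `c, d, m₀` and all large `n` there is an order `m ≥ m₀` with `m^d ≤ n` and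
`(⌊log₂ n⌋ + c)^c < m` — take `m = (⌊log₂ n⌋ + c)^c + m₀ + 1`, a polylogarithm of `n`. [folklore] -/
theorem growth (c d m₀ : ℕ) :
    ∃ n₀ : ℕ, ∀ n : ℕ, n₀ ≤ n → ∃ m : ℕ, m₀ ≤ m ∧ m ^ d ≤ n ∧ (Nat.log 2 n + c) ^ c < m := by
  set B : ℕ := c + m₀ + 2 with hB
  obtain ⟨T, hT⟩ := eventually_mul_pow_lt_two_pow ((c + 1) * d) (2 ^ B)
  refine ⟨2 ^ T, fun n hn => ?_⟩
  set L := Nat.log 2 n with hL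
  have hn0 : n ≠ 0 := by
    have : 0 < 2 ^ T := Nat.two_pow_pos T
    omega
  have hTL : T ≤ L := by
    rw [hL]; exact Nat.le_log_of_pow_le (by norm_num) hn
  refine ⟨(L + c) ^ c + m₀ + 1, by omega, ?_, by omega⟩
  have hm : (L + c) ^ c + m₀ + 1 ≤ (L + B) ^ (c + 1) := by
    have h1 : (L + c) ^ c ≤ (L + B) ^ c := Nat.pow_le_pow_left (by omega) c
    have h2 : 1 ≤ (L + B) ^ c := Nat.one_le_pow _ _ (by omega)
    calc (L + c) ^ c + m₀ + 1 ≤ (L + B) ^ c * 1 + (L + B) ^ c * (m₀ + 1) := by nlinarith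
      _ = (L + B) ^ c * (m₀ + 2) := by ring
      _ ≤ (L + B) ^ c * (L + B) := Nat.mul_le_mul_left _ (by omega)
      _ = (L + B) ^ (c + 1) := (pow_succ _ _).symm
  have hpow : ((L + c) ^ c + m₀ + 1) ^ d ≤ (L + B) ^ ((c + 1) * d) := by
    calc ((L + c) ^ c + m₀ + 1) ^ d ≤ ((L + B) ^ (c + 1)) ^ d := Nat.pow_le_pow_left hm d
      _ = (L + B) ^ ((c + 1) * d) := (pow_mul _ _ _).symm
  have hlt : (L + B) ^ ((c + 1) * d) < 2 ^ L := by
    have h := hT (L + B) (by omega)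
    have e : (2 : ℕ) ^ (L + B) = 2 ^ B * 2 ^ L := by rw [pow_add, mul_comm]
    rw [e] at h
    exact Nat.lt_of_mul_lt_mul_left h
  have hlog : 2 ^ L ≤ n := by rw [hL]; exact Nat.pow_log_le_self 2 hn0
  exact (hpow.trans hlt.le).trans hlog

/-! ## The composition: the crux from the three stubs -/

/-- **The crux from the stubs.**  Given `c`: stub 1 gives `d, m₀` and face counters of every order
`m ≥ m₀` in some `DS_N`, `N ≤ m^d`; `growth` picks, for all large `n`, an order `m ≥ m₀` with
`m^d ≤ n` and `2^{(⌊log₂ n⌋+c)^c} < 2^m`; stub 2 pads the face counter from `DS_N` to `DS_n`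
(same value set, so domination and the equality values persist); stub 3 turns its `≥ 2^m`
equality values into `≥ 2^m` shadow vertices of `DS_n`. -/
theorem ShadowBirkhoff_of : ShadowBirkhoff := by
  classical
  intro c
  obtain ⟨d, m₀, hF⟩ := stub_registerFaces
  obtain ⟨n₀, hgrow⟩ := growth c d m₀
  refine ⟨n₀, fun n hn => ?_⟩
  obtain ⟨m, hm₀, hmd, hlt⟩ := hgrow n hn
  obtain ⟨N, hN, G, wb, wa, φ, ψ, hφ, hdom, hcount⟩ := hF m hm₀
  obtain ⟨G', wb', wa', hset⟩ := stub_facePad (hN.trans hmd) G wb wa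
  -- domination persists on the padded face
  have hdom' : ∀ ρ' : Equiv.Perm (Fin n), (∀ u, (u, ρ' u) ∈ G') →
      φ (∑ u, wb' u (ρ' u)) ≤ ∑ u, wa' u (ρ' u) := by
    intro ρ' hρ'
    have hp : (∑ u, wb' u (ρ' u), ∑ u, wa' u (ρ' u)) ∈
        {p : ℝ × ℝ | ∃ ρ : Equiv.Perm (Fin N), (∀ u, (u, ρ u) ∈ G) ∧
          (∑ u, wb u (ρ u), ∑ u, wa u (ρ u)) = p} :=
      hset.subset ⟨ρ', hρ', rfl⟩
    obtain ⟨ρ, hρ, hpeq⟩ := hp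
    obtain ⟨h1, h2⟩ := Prod.mk.inj hpeq
    rw [← h1, ← h2]
    exact hdom ρ hρ
  obtain ⟨L, hL⟩ := stub_faceVertices G' wb' wa' φ ψ hφ hdom'
  refine ⟨L, ?_⟩
  -- the equality values persist on the padded face
  have hsub : {t : ℝ | ∃ ρ : Equiv.Perm (Fin N), (∀ u, (u, ρ u) ∈ G) ∧
        ∑ u, wb u (ρ u) = t ∧ ∑ u, wa u (ρ u) = φ t} ⊆
      {t : ℝ | ∃ ρ' : Equiv.Perm (Fin n), (∀ u, (u, ρ' u) ∈ G') ∧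
        ∑ u, wb' u (ρ' u) = t ∧ ∑ u, wa' u (ρ' u) = φ t} := by
    rintro t ⟨ρ, hρ, hb, ha⟩
    have hp : (∑ u, wb u (ρ u), ∑ u, wa u (ρ u)) ∈
        {p : ℝ × ℝ | ∃ ρ' : Equiv.Perm (Fin n), (∀ u, (u, ρ' u) ∈ G') ∧
          (∑ u, wb' u (ρ' u), ∑ u, wa' u (ρ' u)) = p} :=
      hset.symm.subset ⟨ρ, hρ, rfl⟩
    obtain ⟨ρ', hρ', hpeq⟩ := hp
    obtain ⟨h1, h2⟩ := Prod.mk.inj hpeq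
    exact ⟨ρ', hρ', h1.trans hb, h2.trans ha⟩
  have hfin : {t : ℝ | ∃ ρ' : Equiv.Perm (Fin n), (∀ u, (u, ρ' u) ∈ G') ∧
        ∑ u, wb' u (ρ' u) = t ∧ ∑ u, wa' u (ρ' u) = φ t}.Finite :=
    (Set.finite_range fun ρ' : Equiv.Perm (Fin n) => ∑ u, wb' u (ρ' u)).subset
      (by rintro t ⟨ρ', -, hb, -⟩; exact ⟨ρ', hb⟩)
  have key : 2 ^ ((Nat.log 2 n + c) ^ c) < birkhoffShadowVertexCount L :=
    calc 2 ^ ((Nat.log 2 n + c) ^ c) < 2 ^ m := Nat.pow_lt_pow_right (by norm_num) hlt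
      _ ≤ _ := hcount
      _ ≤ _ := Set.ncard_le_ncard hsub hfin
      _ ≤ birkhoffShadowVertexCount L := hL
  exact key

end Summit.ValiantsHypothesis.ValiantsHypothesis.Cruxes.ShadowBirkhoff.ParabolaRegisterFace

end
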